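import Mathlib
import HarnessLib
import Summits.Ventures.LatticeQCDFlow.Scoring.SplitChainAnscombe

/-!
# The time average versus the tour sums: `Σ_{t<n} f̄(X_t) = Z_0 + Σ_{i ≤ K_{n−1}} Z_i − Q_n` pathwise,
# and `(Σ_{t<n} f̄(X_t) − Σ_{i ≤ ⌊e n⌋} Z_i)/√n → 0` in probability, from any start

HONEST FRAMING: exact (Metropolis-corrected) sampling algorithms for lattice gauge theory;
figures of merit are autocorrelation/cost numbers at stated couplings and volumes; no
continuum-physics claim.

Venture `LatticeQCDFlow` (cell pub-lqcd), topic `Scoring`; FANOUT row 8 (`s0-cpn-nemc`, GEN-18).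
NEW WORK of the cell, not a published result; no definition is introduced.  Notation of
`Scoring/SplitChainAnscombe.lean`.  (i) PATHWISE: when every tour ends, the sum of `g(X_t)` over
`t < n` equals the sum of the full tour sums `S^g_i` over the tours `i ≤ K_{n−1}` started by time
`n − 1`, minus the RESIDUAL `Q_n = Σ_{u ≥ n, K_u = K_{n−1}} g(X_u)` (the part of the tour in
progress at time `n` lying beyond `n`); `|Q_n| ≤ sup|g| · (residual life)`, and the residual life
has the geometric tail of `Scoring/SplitChainCoinCount.lean`.  (ii) IN PROBABILITY: with `Z_i` the
centred tour sums, `a_n = ⌊e n⌋`,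
`(Σ_{t<n} f̄(X_t) − Σ_{1 ≤ i ≤ a_n} Z_i)/√n = (Z_0 + D_n − Q_n)/√n → 0` in `P̂`-probability: `Z_0` by
Markov's inequality, `D_n` by the second-moment identity `E[D_n²] = v E|K_{n−1} − a_n| = O(√n)` of
`Scoring/SplitChainAnscombe.lean` and Chebyshev, `Q_n` by the geometric tail.  This is the reduction
of the Markov-chain CLT for time averages to the i.i.d. CLT for tour sums
(`Scoring/MarkovChainCLT.lean`).  Printed counterpart NAMED ONLY: the regenerative proof of the
Markov-chain CLT (Chung 1960 §I.16; Meyn–Tweedie 1993 Thm 17.2.2 / 17.3.6) — nothing is cited as a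
fact.

## Content (`π` invariant, `0 < ε < 1`, `|f| ≤ C` measurable, any initial law)

* `timeSum_eq_tourSums_sub_residual` — the pathwise identity (i);
* `abs_residual_le`, `residual_far_subset_tailsRun` — `|Q_n|` against the run of tails after `n`;
* **`splitChain_timeAverage_sub_tourSums_tendstoInMeasure`** — (ii).

NOT CLAIMED: almost-sure versions; rates; anything about a concrete sampler.
-/

noncomputable section

namespace Summit.Ventures.LatticeQCDFlow.Scoring

open MeasureTheory ProbabilityTheory Filter Finset Preorder Literature.Probability.MarkovChains
open scoped ENNReal Topology

/-! ### Pathwise: time sums versus tour sums -/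

section Pathwise

variable {Ω : Type*}

/-- **TIME SUM = TOUR SUMS OF THE STARTED TOURS − RESIDUAL**: if every tour of the path ends, then for
`n ≥ 1`, `Σ_{t<n} g(X_t) = Σ_{i ≤ K_{n−1}} S^g_i − Σ_{u ≥ n, K_u = K_{n−1}} g(X_u)`, and the residual
index set is the interval `[n, T]` where `T + 1` is the start of tour `K_{n−1} + 1`. -/
theorem timeSum_eq_tourSums_sub_residual (g : Ω → ℝ) (x : ℕ → Ω × Bool)
    (hx : ∀ j : ℕ, ∃ t : ℕ, (∑ s ∈ Finset.range t, (if (x (s + 1)).2 then (1 : ℕ) else 0)) = j ∧ (x (t + 1)).2 = true) {n : ℕ} (hn : 0 < n) :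
    ∃ T : ℕ, n - 1 ≤ T ∧ (∑ s ∈ Finset.range T, (if (x (s + 1)).2 then (1 : ℕ) else 0)) = (∑ s ∈ Finset.range (n - 1), (if (x (s + 1)).2 then (1 : ℕ) else 0)) ∧ (x (T + 1)).2 = true
      ∧ (∀ u, n ≤ u → ((∑ s ∈ Finset.range u, (if (x (s + 1)).2 then (1 : ℕ) else 0)) = (∑ s ∈ Finset.range (n - 1), (if (x (s + 1)).2 then (1 : ℕ) else 0)) ↔ u ≤ T))
      ∧ (∑' u, (if n ≤ u then (if (∑ s ∈ Finset.range u, (if (x (s + 1)).2 then (1 : ℕ) else 0)) = (∑ s ∈ Finset.range (n - 1), (if (x (s + 1)).2 then (1 : ℕ) else 0)) then (1 : ℝ) else 0) * g (x u).1 else 0)) = ∑ u ∈ Finset.Ico n (T + 1), g (x u).1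
      ∧ ∑ t ∈ Finset.range n, g (x t).1
        = (∑ i ∈ Finset.range ((∑ s ∈ Finset.range (n - 1), (if (x (s + 1)).2 then (1 : ℕ) else 0)) + 1), (∑' u, (if (∑ s ∈ Finset.range u, (if (x (s + 1)).2 then (1 : ℕ) else 0)) = i then (1 : ℝ) else 0) * g (x u).1)) - (∑' u, (if n ≤ u then (if (∑ s ∈ Finset.range u, (if (x (s + 1)).2 then (1 : ℕ) else 0)) = (∑ s ∈ Finset.range (n - 1), (if (x (s + 1)).2 then (1 : ℕ) else 0)) then (1 : ℝ) else 0) * g (x u).1 else 0)) := by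
  set m := (∑ s ∈ Finset.range (n - 1), (if (x (s + 1)).2 then (1 : ℕ) else 0)) with hm
  obtain ⟨T, hT, hhT⟩ := hx m
  -- `n - 1 ≤ T`
  have hnT : n - 1 ≤ T := by
    by_contra hlt
    have h1 := headCount_mono x (show T + 1 ≤ n - 1 by omega)
    rw [headCount_succ, hT, hhT] at h1
    simp only [if_true] at h1
    omega
  -- characterisation of the residual times
  have hres : ∀ u, n ≤ u → ((∑ s ∈ Finset.range u, (if (x (s + 1)).2 then (1 : ℕ) else 0)) = m ↔ u ≤ T) := by
    intro u hu
    constructor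
    · intro h
      by_contra hlt
      have h1 := headCount_mono x (show T + 1 ≤ u by omega)
      rw [headCount_succ, hT, hhT] at h1
      simp only [if_true] at h1
      omega
    · intro h
      have h1 := headCount_mono x h
      have h2 := headCount_mono x (show n - 1 ≤ u by omega)
      rw [hT] at h1
      omega
  -- the residual as a finite sum
  have hQ : (∑' u, (if n ≤ u then (if (∑ s ∈ Finset.range u, (if (x (s + 1)).2 then (1 : ℕ) else 0)) = (∑ s ∈ Finset.range (n - 1), (if (x (s + 1)).2 then (1 : ℕ) else 0)) then (1 : ℝ) else 0) * g (x u).1 else 0)) = ∑ u ∈ Finset.Ico n (T + 1), g (x u).1 := by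
    rw [tsum_eq_sum (s := Finset.Ico n (T + 1))]
    · refine Finset.sum_congr rfl fun u hu => ?_
      obtain ⟨hu1, hu2⟩ := Finset.mem_Ico.1 hu
      rw [if_pos hu1, if_pos ((hres u hu1).2 (by omega)), one_mul]
    · intro u hu
      rw [Finset.mem_Ico, not_and_or] at hu
      by_cases h1 : n ≤ u
      · have h2 : ¬ u ≤ T := by omega
        rw [if_pos h1, if_neg (fun h => h2 ((hres u h1).1 h)), zero_mul]
      · rw [if_neg h1]
  -- every tour `i ≤ m` is a finite sum over `u ≤ T`
  have hS : ∀ i ∈ Finset.range (m + 1), (∑' u, (if (∑ s ∈ Finset.range u, (if (x (s + 1)).2 then (1 : ℕ) else 0)) = i then (1 : ℝ) else 0) * g (x u).1)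
      = ∑ u ∈ Finset.range (T + 1), (if (∑ s ∈ Finset.range u, (if (x (s + 1)).2 then (1 : ℕ) else 0)) = i then (1 : ℝ) else 0) * g (x u).1 := fun i hi =>
    tourSum_eq_finsetSum (fun p _ => g p.1) x (by have := Finset.mem_range.1 hi; omega) hT hhT
  have hone : ∀ u ∈ Finset.range (T + 1),
      ∑ i ∈ Finset.range (m + 1), (if (∑ s ∈ Finset.range u, (if (x (s + 1)).2 then (1 : ℕ) else 0)) = i then (1 : ℝ) else 0) * g (x u).1 = g (x u).1 := by
    intro u hu
    have hKu : (∑ s ∈ Finset.range u, (if (x (s + 1)).2 then (1 : ℕ) else 0)) ≤ m := by rw [← hT]; exact headCount_mono x (by have := Finset.mem_range.1 hu; omega)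
    rw [← Finset.sum_mul, Finset.sum_ite_eq, if_pos (Finset.mem_range.2 (by omega)), one_mul]
  refine ⟨T, hnT, hT, hhT, hres, hQ, ?_⟩
  rw [hQ, Finset.sum_congr rfl hS, Finset.sum_comm, Finset.sum_congr rfl hone,
    ← Finset.sum_range_add_sum_Ico _ (show n ≤ T + 1 by omega)]
  ring

/-- `|Q_n| ≤ C_g · #[n, T]` for `|g| ≤ C_g`, with `T` as in `timeSum_eq_tourSums_sub_residual`. -/
theorem abs_sum_Ico_le {g : Ω → ℝ} {Cg : ℝ} (hCg : ∀ y, |g y| ≤ Cg) (x : ℕ → Ω × Bool) (n T : ℕ) :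
    |∑ u ∈ Finset.Ico n (T + 1), g (x u).1| ≤ Cg * ((T + 1 - n : ℕ) : ℝ) := by
  refine (Finset.abs_sum_le_sum_abs _ _).trans ?_
  calc ∑ u ∈ Finset.Ico n (T + 1), |g (x u).1| ≤ ∑ u ∈ Finset.Ico n (T + 1), Cg :=
        Finset.sum_le_sum fun u _ => hCg _
    _ = Cg * ((T + 1 - n : ℕ) : ℝ) := by rw [Finset.sum_const, Nat.card_Ico, nsmul_eq_mul, mul_comm]

end Pathwise

/-! ### In probability: the residual terms are `o(√n)` -/

section Residual

variable {Ω : Type*} [MeasurableSpace Ω]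
  {κ : Kernel Ω Ω} [IsMarkovKernel κ] {ν : Measure Ω} [IsProbabilityMeasure ν] {ε : ℝ≥0∞}
  {hmin : ∀ x {B : Set Ω}, MeasurableSet B → ε * ν B ≤ κ x B}
  (κs : Kernel (Ω × Bool) (Ω × Bool)) [IsMarkovKernel κs]
  (μs : Measure (Ω × Bool)) [IsProbabilityMeasure μs]

/-- **THE TIME AVERAGE AND THE SUM OF THE FIRST `⌊e n⌋` TOURS DIFFER BY `o_P(√n)`**: `π` invariant,
`0 < ε < 1`, `|f| ≤ C` measurable, any initial law:
`(√n)⁻¹ (Σ_{t<n} (f(X_t) − π f) − Σ_{i<⌊e n⌋} Z_{i+1}) → 0` in `P̂`-probability. -/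
theorem splitChain_timeAverage_sub_tourSums_tendstoInMeasure {π : Measure Ω} [IsProbabilityMeasure π]
    (hπ : Kernel.Invariant κ π) (hε0 : 0 < ε) (hε : ε < 1)
    (hκs : ∀ p, κs p = (ε • ν).map (fun y : Ω => (y, true))
      + ((1 - ε) • Doeblin.residualKernel κ ν ε hmin p.1).map (fun y : Ω => (y, false)))
    {f : Ω → ℝ} (hf : Measurable f) {C : ℝ} (hC : ∀ x, |f x| ≤ C) :
    TendstoInMeasure (Kernel.trajMeasure (X := fun _ : ℕ => Ω × Bool) μs
        (fun n : ℕ => κs.comap (fun h : (i : ↥(Finset.Iic n)) → Ω × Bool =>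
          h ⟨n, Finset.mem_Iic.2 le_rfl⟩) (measurable_pi_apply _)))
      (fun (n : ℕ) (x : ℕ → Ω × Bool) =>
        (Real.sqrt n)⁻¹ * ((∑ t ∈ Finset.range n, (f (x t).1 - ∫ z, f z ∂π))
          - ∑ i ∈ Finset.range ⌊ε.toReal * n⌋₊, (∑' u, (if (∑ s ∈ Finset.range u, (if (x (s + 1)).2 then (1 : ℕ) else 0)) = i + 1 then (1 : ℝ) else 0) * (f (x u).1 - ∫ z, f z ∂π))))
      atTop (fun _ => 0) := by
  haveI hνt : IsProbabilityMeasure (ν.map (fun y : Ω => (y, true))) :=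
    Measure.isProbabilityMeasure_map (measurable_tagCoin true).aemeasurable
  set P := (Kernel.trajMeasure (X := fun _ : ℕ => Ω × Bool) μs
        (fun n : ℕ => κs.comap (fun h : (i : ↥(Finset.Iic n)) → Ω × Bool =>
          h ⟨n, Finset.mem_Iic.2 le_rfl⟩) (measurable_pi_apply _))) with hP
  set Pν := (Kernel.trajMeasure (X := fun _ : ℕ => Ω × Bool) (ν.map (fun y : Ω => (y, true)))
        (fun n : ℕ => κs.comap (fun h : (i : ↥(Finset.Iic n)) → Ω × Bool =>
          h ⟨n, Finset.mem_Iic.2 le_rfl⟩) (measurable_pi_apply _))) with hPν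
  set c := ∫ z, f z ∂π with hc
  set v := ∫ y, (∑' u, (if (∑ s ∈ Finset.range u, (if (y (s + 1)).2 then (1 : ℕ) else 0)) = 0 then (1 : ℝ) else 0) * (f (y u).1 - c)) ^ 2 ∂Pν with hv
  have he0 : 0 < ε.toReal := ENNReal.toReal_pos hε0.ne' (ne_top_of_lt hε)
  have he1 : ε.toReal ≤ 1 := ENNReal.toReal_le_of_le_ofReal zero_le_one
    (by rw [ENNReal.ofReal_one]; exact hε.le)
  obtain ⟨hg, hCg, -⟩ := centred_observable_bounds π hf hC
  have hC0 : 0 ≤ C := (abs_nonneg _).trans (hC (Classical.choice (nonempty_of_isProbabilityMeasure π)))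
  have hv0 : 0 ≤ v := integral_nonneg fun y => sq_nonneg _
  have hae := splitChain_ae_tourStart κs μs (κ := κ) (ν := ν) (hmin := hmin) hε0 hε hκs
  rw [← hP] at hae
  -- notation for the pieces
  set Zt : ℕ → (ℕ → Ω × Bool) → ℝ := fun i x => (∑' u, (if (∑ s ∈ Finset.range u, (if (x (s + 1)).2 then (1 : ℕ) else 0)) = i then (1 : ℝ) else 0) * (f (x u).1 - c)) with hZt
  set a : ℕ → ℕ := fun n => ⌊ε.toReal * n⌋₊ with ha
  have haN : ∀ n : ℕ, a n ≤ n := fun n => by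
    simp only [ha]
    refine Nat.floor_le_of_le ?_
    calc ε.toReal * n ≤ 1 * n := mul_le_mul_of_nonneg_right he1 (Nat.cast_nonneg n)
      _ = n := one_mul _
  set Dn : ℕ → (ℕ → Ω × Bool) → ℝ := fun n x => ∑ i ∈ Finset.range (2 * n),
      ((if i + 1 ≤ (∑ s ∈ Finset.range (n - 1), (if (x (s + 1)).2 then (1 : ℕ) else 0)) then (1 : ℝ) else 0) - (if i + 1 ≤ a n then (1 : ℝ) else 0))
        * Zt (i + 1) x with hDn
  set Qn : ℕ → (ℕ → Ω × Bool) → ℝ := fun n x => (∑' u, (if n ≤ u then (if (∑ s ∈ Finset.range u, (if (x (s + 1)).2 then (1 : ℕ) else 0)) = (∑ s ∈ Finset.range (n - 1), (if (x (s + 1)).2 then (1 : ℕ) else 0)) then (1 : ℝ) else 0) * (fun y : Ω => f y - c) (x u).1 else 0)) with hQn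
  -- (0) the pathwise identity on the almost sure set, for `n ≥ 1`
  have hident : ∀ n : ℕ, 0 < n → ∀ x : ℕ → Ω × Bool,
      (∀ j : ℕ, ∃ t : ℕ, (∑ s ∈ Finset.range t, (if (x (s + 1)).2 then (1 : ℕ) else 0)) = j ∧ (x (t + 1)).2 = true) →
      (∑ t ∈ Finset.range n, (f (x t).1 - c)) - ∑ i ∈ Finset.range (a n), Zt (i + 1) x
        = Zt 0 x + Dn n x - Qn n x := by
    intro n hn x hx
    obtain ⟨T, hnT, hT, hhT, hres, hQ, hsum⟩ :=
      timeSum_eq_tourSums_sub_residual (fun y => f y - c) x hx hn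
    have hKle : (∑ s ∈ Finset.range (n - 1), (if (x (s + 1)).2 then (1 : ℕ) else 0)) ≤ 2 * n := by
      calc (∑ s ∈ Finset.range (n - 1), (if (x (s + 1)).2 then (1 : ℕ) else 0)) ≤ ∑ s ∈ Finset.range (n - 1), 1 :=
          Finset.sum_le_sum fun s _ => by split_ifs <;> norm_num
        _ ≤ 2 * n := by simp; omega
    -- `Σ_{i<2n} 1{i+1 ≤ K} Z_{i+1} = Σ_{i<K} Z_{i+1}`, `Σ_{i<2n} 1{i+1 ≤ a} Z_{i+1} = Σ_{i<a} Z_{i+1}`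
    have htrunc : ∀ k : ℕ, k ≤ 2 * n →
        ∑ i ∈ Finset.range (2 * n), (if i + 1 ≤ k then (1 : ℝ) else 0) * Zt (i + 1) x
          = ∑ i ∈ Finset.range k, Zt (i + 1) x := by
      intro k hk
      rw [← Finset.sum_range_add_sum_Ico _ hk]
      rw [Finset.sum_eq_zero (s := Finset.Ico k (2 * n)) (fun i hi => by
        rw [if_neg (by have := (Finset.mem_Ico.1 hi).1; omega), zero_mul]), add_zero]
      exact Finset.sum_congr rfl fun i hi => by rw [if_pos (by have := Finset.mem_range.1 hi; omega), one_mul]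
    have hD : Dn n x = (∑ i ∈ Finset.range (∑ s ∈ Finset.range (n - 1), (if (x (s + 1)).2 then (1 : ℕ) else 0)), Zt (i + 1) x)
        - ∑ i ∈ Finset.range (a n), Zt (i + 1) x := by
      simp only [hDn, sub_mul, Finset.sum_sub_distrib]
      rw [htrunc _ hKle, htrunc _ ((haN n).trans (by omega))]
    rw [hD, hsum, Finset.sum_range_succ']
    simp only [hZt, hQn]
    ring
  -- integrability: `Z_0`, and `D_n²` with its second-moment bound
  have hZ0I : Integrable (fun x => Zt 0 x) P := by
    have h := splitChain_integrable_tourSum κs μs (κ := κ) (ν := ν) (hmin := hmin) hε0 hε hκs hg hCg 0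
    rw [← hP] at h
    exact h
  have hDsq : ∀ n : ℕ, 0 < n → Integrable (fun x => Dn n x ^ 2) P
      ∧ ∫ x, Dn n x ^ 2 ∂P ≤ v * (Real.sqrt n + 2) := by
    intro n hn
    have hmN : n - 1 < 2 * n := by omega
    have haN2 : a n ≤ 2 * n := (haN n).trans (by omega)
    have h1 := splitChain_anscombe_sq_eq κs μs (κ := κ) (ν := ν) (hmin := hmin) hπ hε0 hε hκs hf hC hmN
      haN2
    have h2 := splitChain_anscombe_sq_le κs μs (κ := κ) (ν := ν) (hmin := hmin) hπ hε0 hε hκs hf hC hmN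
      haN2
    rw [← hP, ← hPν] at h1
    rw [← hP, ← hPν] at h2
    refine ⟨h1.1, h2.trans (mul_le_mul_of_nonneg_left ?_ hv0)⟩
    have hs : Real.sqrt ((n - 1 : ℕ) : ℝ) ≤ Real.sqrt n :=
      Real.sqrt_le_sqrt (by exact_mod_cast Nat.sub_le n 1)
    have hfl : |ε.toReal * ((n - 1 : ℕ) : ℝ) - (a n : ℝ)| ≤ 2 := by
      have hcast : ((n - 1 : ℕ) : ℝ) = n - 1 := by
        rw [Nat.cast_sub (by omega : 1 ≤ n)]; simp
      rw [hcast]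
      have h0 : (0 : ℝ) ≤ ε.toReal * n := by positivity
      have hf1 : ((⌊ε.toReal * n⌋₊ : ℕ) : ℝ) ≤ ε.toReal * n := Nat.floor_le h0
      have hf2 : ε.toReal * n < ((⌊ε.toReal * n⌋₊ : ℕ) : ℝ) + 1 := Nat.lt_floor_add_one _
      simp only [ha]
      rw [abs_le]; constructor <;> nlinarith
    linarith
  -- the three vanishing bounds
  rw [tendstoInMeasure_iff_measureReal_norm]
  intro δ hδ
  have hsqrt : Tendsto (fun n : ℕ => Real.sqrt n) atTop atTop :=
    Real.tendsto_sqrt_atTop.comp tendsto_natCast_atTop_atTop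
  have hA : Tendsto (fun n : ℕ => 3 * (∫ x, |Zt 0 x| ∂P) * (δ * Real.sqrt n)⁻¹) atTop (𝓝 0) := by
    have h := tendsto_inv_atTop_zero.comp (hsqrt.const_mul_atTop hδ)
    simpa using h.const_mul (3 * ∫ x, |Zt 0 x| ∂P)
  have hB : Tendsto (fun n : ℕ => 9 * v / δ ^ 2 * (Real.sqrt n / n + 2 / n)) atTop (𝓝 0) := by
    have h1 : Tendsto (fun n : ℕ => Real.sqrt n / n) atTop (𝓝 0) := by
      have h := tendsto_inv_atTop_zero.comp hsqrt
      refine h.congr fun n => ?_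
      simp only [Function.comp_apply]
      rw [Real.sqrt_div_self', one_div]
    have h2 : Tendsto (fun n : ℕ => (2 : ℝ) / n) atTop (𝓝 0) := tendsto_const_div_atTop_nhds_zero_nat 2
    simpa using (h1.add h2).const_mul (9 * v / δ ^ 2)
  have hCt : Tendsto (fun n : ℕ => (1 - ε.toReal) ^ ⌈δ * Real.sqrt n / (6 * (C + 1))⌉₊) atTop (𝓝 0) := by
    have hj : Tendsto (fun n : ℕ => ⌈δ * Real.sqrt n / (6 * (C + 1))⌉₊) atTop atTop :=
      tendsto_nat_ceil_atTop.comp ((hsqrt.const_mul_atTop hδ).atTop_div_const (by positivity))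
    exact (tendsto_pow_atTop_nhds_zero_of_lt_one (by linarith) (by linarith)).comp hj
  have hsumT : Tendsto (fun n : ℕ => 3 * (∫ x, |Zt 0 x| ∂P) * (δ * Real.sqrt n)⁻¹
      + 9 * v / δ ^ 2 * (Real.sqrt n / n + 2 / n)
      + (1 - ε.toReal) ^ ⌈δ * Real.sqrt n / (6 * (C + 1))⌉₊) atTop (𝓝 0) := by
    have h := (hA.add hB).add hCt
    rw [add_zero, add_zero] at h
    exact h
  refine squeeze_zero' (Eventually.of_forall fun n => measureReal_nonneg) ?_ hsumT
  filter_upwards [eventually_gt_atTop 0] with n hn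
  have hn0 : (0 : ℝ) < n := Nat.cast_pos.2 hn
  have hsq0 : 0 < Real.sqrt n := Real.sqrt_pos.2 hn0
  have hsq : Real.sqrt n ^ 2 = n := Real.sq_sqrt hn0.le
  set θ : ℝ := δ * Real.sqrt n / 3 with hθ
  have hθ0 : 0 < θ := by positivity
  -- the events
  set S1 : Set (ℕ → Ω × Bool) := {x | θ ≤ |Zt 0 x|} with hS1
  set S2 : Set (ℕ → Ω × Bool) := {x | θ ^ 2 ≤ Dn n x ^ 2} with hS2
  set S3 : Set (ℕ → Ω × Bool) := {x | ∀ i < ⌈δ * Real.sqrt n / (6 * (C + 1))⌉₊,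
    (x (n - 1 + i + 1)).2 = false} with hS3
  set Bad : Set (ℕ → Ω × Bool) := {x | ¬ ∀ j : ℕ, ∃ t : ℕ,
    (∑ s ∈ Finset.range t, (if (x (s + 1)).2 then (1 : ℕ) else 0)) = j ∧ (x (t + 1)).2 = true} with hBad
  -- inclusion
  have hincl : {x : ℕ → Ω × Bool | δ ≤ ‖(Real.sqrt n)⁻¹ * ((∑ t ∈ Finset.range n, (f (x t).1 - c))
      - ∑ i ∈ Finset.range ⌊ε.toReal * n⌋₊, (∑' u, (if (∑ s ∈ Finset.range u, (if (x (s + 1)).2 then (1 : ℕ) else 0)) = i + 1 then (1 : ℝ) else 0) * (f (x u).1 - c))) - 0‖}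
      ⊆ S1 ∪ S2 ∪ S3 ∪ Bad := by
    intro x hx
    simp only [Set.mem_setOf_eq, sub_zero, Real.norm_eq_abs] at hx
    by_cases hgood : ∀ j : ℕ, ∃ t : ℕ, (∑ s ∈ Finset.range t, (if (x (s + 1)).2 then (1 : ℕ) else 0)) = j ∧ (x (t + 1)).2 = true
    swap
    · exact Or.inr hgood
    left
    by_contra hnot
    simp only [Set.mem_union, not_or] at hnot
    obtain ⟨⟨h1, h2⟩, h3⟩ := hnot
    simp only [hS1, hS2, hS3, Set.mem_setOf_eq, not_le] at h1 h2 h3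
    -- bounds on the three pieces
    have hZ0 : |Zt 0 x| < θ := h1
    have hD : |Dn n x| < θ := abs_lt_of_sq_lt_sq h2 hθ0.le
    have hQ : |Qn n x| < θ := by
      by_contra hQ
      push Not at hQ
      apply h3
      intro i hi
      obtain ⟨T, hnT, hT, hhT, hres, hQ', -⟩ :=
        timeSum_eq_tourSums_sub_residual (fun y => f y - c) x hgood hn
      have hQeq : Qn n x = ∑ u ∈ Finset.Ico n (T + 1), (f (x u).1 - c) := hQ'
      have hbound := abs_sum_Ico_le (g := fun y => f y - c) hCg x n T
      rw [← hQeq] at hbound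
      -- the run of tails is at least `j n` long
      have hlen : δ * Real.sqrt n / (6 * (C + 1)) ≤ ((T + 1 - n : ℕ) : ℝ) := by
        rw [div_le_iff₀ (by positivity)]
        have : θ ≤ 2 * C * ((T + 1 - n : ℕ) : ℝ) := hQ.trans hbound
        have hcn : (0 : ℝ) ≤ ((T + 1 - n : ℕ) : ℝ) := Nat.cast_nonneg _
        simp only [hθ] at this
        nlinarith
      have hj : ⌈δ * Real.sqrt n / (6 * (C + 1))⌉₊ ≤ T + 1 - n := Nat.ceil_le.2 hlen
      have hu : n + i ≤ T := by omega
      have hK1 : (∑ s ∈ Finset.range (n + i), (if (x (s + 1)).2 then (1 : ℕ) else 0)) = (∑ s ∈ Finset.range (n - 1), (if (x (s + 1)).2 then (1 : ℕ) else 0)) := (hres (n + i) (by omega)).2 hu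
      have hK2 := headCount_mono x (show n - 1 ≤ n + i - 1 by omega)
      have hK3 := headCount_succ x (n + i - 1)
      rw [show n + i - 1 + 1 = n + i by omega] at hK3
      rw [show n - 1 + i + 1 = n + i by omega]
      by_contra hc
      rw [Bool.not_eq_false] at hc
      rw [hc] at hK3
      simp only [if_true] at hK3
      omega
    -- contradiction with `δ ≤ |F n x|`
    have hid := hident n hn x hgood
    rw [hid] at hx
    have : |(Real.sqrt n)⁻¹ * (Zt 0 x + Dn n x - Qn n x)| < δ := by
      rw [abs_mul, abs_of_pos (inv_pos.2 hsq0)]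
      have htri : |Zt 0 x + Dn n x - Qn n x| < 3 * θ := by
        calc |Zt 0 x + Dn n x - Qn n x| ≤ |Zt 0 x + Dn n x| + |Qn n x| := abs_sub _ _
          _ ≤ |Zt 0 x| + |Dn n x| + |Qn n x| := by gcongr; exact abs_add_le _ _
          _ < θ + θ + θ := by linarith
          _ = 3 * θ := by ring
      calc (Real.sqrt n)⁻¹ * |Zt 0 x + Dn n x - Qn n x| < (Real.sqrt n)⁻¹ * (3 * θ) :=
          mul_lt_mul_of_pos_left htri (inv_pos.2 hsq0)
        _ = δ := by simp only [hθ]; field_simp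
    linarith
  -- the probability bounds
  have hP1 : P.real S1 ≤ 3 * (∫ x, |Zt 0 x| ∂P) * (δ * Real.sqrt n)⁻¹ := by
    have h := mul_meas_ge_le_integral_of_nonneg (ae_of_all _ fun x => abs_nonneg (Zt 0 x)) hZ0I.abs θ
    have h' : P.real S1 ≤ (∫ x, |Zt 0 x| ∂P) / θ := (le_div_iff₀' hθ0).2 h
    refine h'.trans (le_of_eq ?_)
    simp only [hθ]
    field_simp
  have hP2 : P.real S2 ≤ 9 * v / δ ^ 2 * (Real.sqrt n / n + 2 / n) := by
    obtain ⟨hI, hE⟩ := hDsq n hn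
    have h := mul_meas_ge_le_integral_of_nonneg (ae_of_all _ fun x => sq_nonneg (Dn n x)) hI (θ ^ 2)
    have h' : P.real S2 ≤ (∫ x, Dn n x ^ 2 ∂P) / θ ^ 2 := (le_div_iff₀' (by positivity)).2 h
    refine h'.trans ((div_le_div_of_nonneg_right hE (by positivity)).trans (le_of_eq ?_))
    simp only [hθ]
    rw [div_pow, mul_pow, hsq]
    field_simp
    ring
  have hP3 : P.real S3 = (1 - ε.toReal) ^ ⌈δ * Real.sqrt n / (6 * (C + 1))⌉₊ :=
    splitChain_tailsRun_measureReal κs μs (κ := κ) (ν := ν) (hmin := hmin) hε hκs (n - 1) _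
  have hBad : P.real Bad = 0 := by
    rw [measureReal_def, ae_iff.1 hae, ENNReal.toReal_zero]
  calc P.real {x : ℕ → Ω × Bool | δ ≤ ‖(Real.sqrt n)⁻¹ * ((∑ t ∈ Finset.range n, (f (x t).1 - c))
        - ∑ i ∈ Finset.range ⌊ε.toReal * n⌋₊, (∑' u, (if (∑ s ∈ Finset.range u, (if (x (s + 1)).2 then (1 : ℕ) else 0)) = i + 1 then (1 : ℝ) else 0) * (f (x u).1 - c))) - 0‖}
      ≤ P.real (S1 ∪ S2 ∪ S3 ∪ Bad) := measureReal_mono hincl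
    _ ≤ P.real (S1 ∪ S2 ∪ S3) + P.real Bad := measureReal_union_le _ _
    _ ≤ P.real S1 + P.real S2 + P.real S3 + P.real Bad := by
        have hu1 := measureReal_union_le (μ := P) (S1 ∪ S2) S3
        have hu2 := measureReal_union_le (μ := P) S1 S2
        linarith
    _ ≤ 3 * (∫ x, |Zt 0 x| ∂P) * (δ * Real.sqrt n)⁻¹ + 9 * v / δ ^ 2 * (Real.sqrt n / n + 2 / n)
        + (1 - ε.toReal) ^ ⌈δ * Real.sqrt n / (6 * (C + 1))⌉₊ := by
        rw [hP3, hBad, add_zero]; linarith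

end Residual

end Summit.Ventures.LatticeQCDFlow.Scoring

end
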